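import Summits.NavierStokesRegularity.NavierStokesRegularity.Theorems.AdaptedFrequencyAdaptedKernelExistsPrekernelBridge
import Summits.NavierStokesRegularity.NavierStokesRegularity.Theorems.AdaptedFrequencyAdaptedKernelExistsPrekernelDecayBox
import Literature.Analysis.FluidPDE.ParabolicLocalEstimatesProofs

/-!
# Crux `AdaptedKernelExists` (stmt-NavierStokesRegularity-2956), line `nash-entropy-last-block`:
  DECAY AT SPATIAL INFINITY for STUB `stub_prekernelBounds` (Lieberman's local maximum principle)

Helper file (lands `--supports stmt-NavierStokesRegularity-2956`) for the registered stub
`stub_prekernelBounds` of the line's skeleton. Setting: `g` jointly smooth on the open slab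
`Ioo ta T × E`, a classical solution of `∂ₜg + b·∇g + νΔg = 0` there (`‖b‖ ≤ B` on `Ico ta T`),
with `Γ + w = g` a.e. on the slab, `Γ = backwardHeatKernel ν T x₀`, `w ∈ L²(ℝ × E)`. For a
general finite-dimensional inner product space `E` this file proves:

* `prekernel_lieberman`: for a block `[t, Ta] ⊆ (ta, T)` and a radius `R` adapted to it, the
  PROVED local maximum principle `Lieberman1996_local_max_holds` (Lieberman 1996, Thm 6.17),
  applied to `±v` for the reversed rescaled solution `v(r, x) = g(T⋆ − r/ν, x)` of
  `v_r + a·∇v − Δv = 0` (`prekernel_bridge`, `T⋆ ∈ (Ta, T)`) on the cylinders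
  `Q((x, ν(T⋆ − s) + R²/2), 2R)`, bounds `|g(s, y)|`, `s ∈ [t, Ta]`, by
  `C (R^{-(n+2)} ∫_{box(y)} |v| + kR)` for every `k > 0`, with ONE box
  `(ν(T⋆ − b′), ν(T⋆ − a′)) × B(y, 2R)` containing all the cylinders;
* `prekernel_decay`: hence (`prekernel_box_subst`, `prekernel_box_small`) for every `δ > 0` there
  is `ρ₀` with `|g(s, y)| ≤ δ` for all `s ∈ [t, Ta]` and `‖y − x₀‖ ≥ ρ₀` — the uniform decay (K1)
  of the smooth representative on every block, used for the positivity and the comparison.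

Its `ℝ³` form `stub_prekernelBounds_decay` is a registered sub-goal of the crux item.
-/

noncomputable section

open MeasureTheory Set Filter Topology Metric Function Real
open scoped Laplacian ContDiff
open Literature.Analysis.FluidPDE Literature.Analysis.UnboundedOperators

namespace Summit.NavierStokesRegularity.NavierStokesRegularity.Theorems.AdaptedKernelExists.NashEntropyLastBlock

section General

variable {E : Type*} [NormedAddCommGroup E] [InnerProductSpace ℝ E] [FiniteDimensional ℝ E]
  [MeasurableSpace E] [BorelSpace E]

/-- **Lieberman's local maximum principle for `±g` on a block.** Let `g` be a smooth classical
solution of `∂ₜg + b·∇g + νΔg = 0` on the open slab `Ioo ta T × E` (`‖b‖ ≤ B` on `Ico ta T`),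
`t ∈ (ta, Ta)`, `Ta < T⋆ < T`, and let the radius `R ∈ (0, 1]` and the time window `(a′, b′)`
satisfy `ta < a′`, `2νa′ + R² ≤ 2νt`, `2νTa + 7R² ≤ 2νb′`, `b′ < T⋆`. Then with the constant
`C = C(E, B/ν, 1)` of `Lieberman1996_local_max_holds`, for all `s ∈ [t, Ta]`, `y`, `k > 0`:
`|g(s, y)| ≤ C (R^{-(n+2)} ∫_{(ν(T⋆−b′), ν(T⋆−a′)) × B(y, 2R)} |g(T⋆ − r/ν, x)| d(r, x) + kR)`
(the principle for `v` and `−v`, `v(r) = g(T⋆ − r/ν)` in the class of `prekernel_bridge`, on the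
cylinder of radius `2R` below the top `ν(T⋆ − s) + R²/2`, whose positive parts are integrated
over a sub-box of the displayed box). -/
theorem prekernel_lieberman {ν ta Ta T Ts B t a' b' R : ℝ} {b : ℝ → E → E} {g : ℝ → E → ℝ}
    (hν : 0 < ν) (ht : t ∈ Ioo ta Ta) (hTs : Ta < Ts) (hTsT : Ts < T)
    (hb : IsSmoothSpaceTimeOn (Ico ta T) b) (hB : ∀ s ∈ Ico ta T, ∀ x, ‖b s x‖ ≤ B)
    (hg : IsSmoothSpaceTimeOn (Ioo ta T) g)
    (heq : ∀ s ∈ Ioo ta T, ∀ x,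
      deriv (fun r => g r x) s + fderiv ℝ (g s) x (b s x) + ν * (Δ (g s)) x = 0)
    (hR : 0 < R) (hR1 : R ≤ 1) (ha' : ta < a') (haR : 2 * ν * a' + R ^ 2 ≤ 2 * ν * t)
    (hbR : 2 * ν * Ta + 7 * R ^ 2 ≤ 2 * ν * b') (hb's : b' < Ts) :
    ∃ C : ℝ, 0 < C ∧ ∀ s ∈ Icc t Ta, ∀ y : E, ∀ k : ℝ, 0 < k →
      |g s y| ≤ C * ((R ^ (Module.finrank ℝ E + 2))⁻¹ *
        (∫ p in Ioo (ν * (Ts - b')) (ν * (Ts - a')) ×ˢ ball y (2 * R),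
          |g (Ts - p.1 / ν) p.2|) + k * R) := by
  obtain ⟨C, hC, hLM⟩ := Lieberman1996_local_max_holds E (A := B / ν) one_pos
  have htaTs : ta < Ts := ht.1.trans (ht.2.trans hTs)
  obtain ⟨a, hv⟩ := prekernel_bridge (t₁ := Ts) hν htaTs hTsT hb hB hg heq
  have hb'T : b' < T := hb's.trans hTsT
  have hR2 : 0 < R ^ 2 := by positivity
  refine ⟨C, hC, fun s hs y k hk => ?_⟩
  -- the cylinder below the top `st = ν (T⋆ - s) + R² / 2`, centred at `y`
  obtain ⟨st, hst⟩ : ∃ st : ℝ, st = ν * (Ts - s) + R ^ 2 / 2 := ⟨_, rfl⟩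
  have hνs : ν * (Ts - Ta) ≤ ν * (Ts - s) := mul_le_mul_of_nonneg_left (by linarith [hs.2]) hν.le
  have hνt : ν * (Ts - s) ≤ ν * (Ts - t) := mul_le_mul_of_nonneg_left (by linarith [hs.1]) hν.le
  have hνb : ν * (b' - Ta) < ν * (Ts - Ta) := mul_lt_mul_of_pos_left (by linarith) hν
  have h4R : 4 * R ^ 2 < st := by nlinarith
  have hstS : Ioc 0 st ⊆ Ico 0 (ν * (Ts - ta)) := fun r hr => ⟨hr.1.le, by nlinarith [hr.2]⟩
  have hcl := hv.mono hstS (Subset.refl _)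
  have hcl' := hv.neg.mono hstS (Subset.refl _)
  have hr₀ : ν * (Ts - s) ∈ Ioo (st - R ^ 2) st := ⟨by linarith, by linarith⟩
  have hy : y ∈ ball y R := mem_ball_self hR
  have e1 : Ts - ν * (Ts - s) / ν = s := by field_simp; ring
  -- Lieberman for `v` and for `−v`
  have key₁ := hLM (T := st) (u := fun σ => g (Ts - σ / ν)) isOpen_univ hcl.measurable_drift
    (fun r hr x _ => hcl.norm_drift_le r hr x (mem_univ x)) (fun r hr => hcl.contDiffOn r hr)
    hcl.continuousOn_fderiv hcl.continuousOn_laplacian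
    (fun x _ r₁ r₂ h0 h12 h2T => hcl.integral_eq x (mem_univ x) r₁ ⟨h0, h12.trans h2T⟩ r₂
      ⟨h0.trans_le h12, h2T⟩ h12)
    hR hR1 hk (subset_univ _) h4R le_rfl hr₀ hy
  have key₂ := hLM (T := st) (u := fun σ x => -g (Ts - σ / ν) x) isOpen_univ hcl'.measurable_drift
    (fun r hr x _ => hcl'.norm_drift_le r hr x (mem_univ x)) (fun r hr => hcl'.contDiffOn r hr)
    hcl'.continuousOn_fderiv hcl'.continuousOn_laplacian
    (fun x _ r₁ r₂ h0 h12 h2T => hcl'.integral_eq x (mem_univ x) r₁ ⟨h0, h12.trans h2T⟩ r₂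
      ⟨h0.trans_le h12, h2T⟩ h12)
    hR hR1 hk (subset_univ _) h4R le_rfl hr₀ hy
  beta_reduce at key₁ key₂
  rw [e1] at key₁ key₂
  -- the integrals of the positive parts over the cylinder are below the box integral of `|v|`
  have hQsub : Ioo (st - (2 * R) ^ 2) st ×ˢ ball y (2 * R) ⊆
      Ioo (ν * (Ts - b')) (ν * (Ts - a')) ×ˢ ball y (2 * R) :=
    Set.prod_mono (Ioo_subset_Ioo (by nlinarith) (by nlinarith)) Subset.rfl
  have hIbig := prekernel_integrableOn_rev (Ts := Ts) (r := 2 * R) hν ha' hb'T hg y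
  have hI₁ : ∫ p in Ioo (st - (2 * R) ^ 2) st ×ˢ ball y (2 * R), max (g (Ts - p.1 / ν) p.2) 0 ≤
      ∫ p in Ioo (ν * (Ts - b')) (ν * (Ts - a')) ×ˢ ball y (2 * R), |g (Ts - p.1 / ν) p.2| :=
    calc ∫ p in Ioo (st - (2 * R) ^ 2) st ×ˢ ball y (2 * R), max (g (Ts - p.1 / ν) p.2) 0
        ≤ ∫ p in Ioo (st - (2 * R) ^ 2) st ×ˢ ball y (2 * R), |g (Ts - p.1 / ν) p.2| :=
          integral_mono_of_nonneg (Eventually.of_forall fun p => le_max_right _ _)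
            (hIbig.mono_set hQsub)
            (Eventually.of_forall fun p => max_le (le_abs_self _) (abs_nonneg _))
      _ ≤ _ := setIntegral_mono_set hIbig (Eventually.of_forall fun p => abs_nonneg _)
            hQsub.eventuallyLE
  have hI₂ : ∫ p in Ioo (st - (2 * R) ^ 2) st ×ˢ ball y (2 * R), max (-g (Ts - p.1 / ν) p.2) 0 ≤
      ∫ p in Ioo (ν * (Ts - b')) (ν * (Ts - a')) ×ˢ ball y (2 * R), |g (Ts - p.1 / ν) p.2| :=
    calc ∫ p in Ioo (st - (2 * R) ^ 2) st ×ˢ ball y (2 * R), max (-g (Ts - p.1 / ν) p.2) 0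
        ≤ ∫ p in Ioo (st - (2 * R) ^ 2) st ×ˢ ball y (2 * R), |g (Ts - p.1 / ν) p.2| :=
          integral_mono_of_nonneg (Eventually.of_forall fun p => le_max_right _ _)
            (hIbig.mono_set hQsub)
            (Eventually.of_forall fun p => max_le (neg_le_abs _) (abs_nonneg _))
      _ ≤ _ := setIntegral_mono_set hIbig (Eventually.of_forall fun p => abs_nonneg _)
            hQsub.eventuallyLE
  have hRn : 0 ≤ (R ^ (Module.finrank ℝ E + 2))⁻¹ := by positivity
  rw [abs_le]
  constructor
  · have h := mul_le_mul_of_nonneg_left hI₂ hRn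
    nlinarith [key₂, h, hC]
  · have h := mul_le_mul_of_nonneg_left hI₁ hRn
    nlinarith [key₁, h, hC]

/-- **Uniform decay at spatial infinity on a block (K1).** In the setting of the stub (`g` a
smooth classical solution on the open slab with `Γ + w = g` a.e., `w ∈ L²(ℝ × E)`, `‖b‖ ≤ B`),
for every `t ∈ (ta, Ta)` and `δ > 0` there is `ρ₀` such that `|g(s, y)| ≤ δ` for all
`s ∈ [t, Ta]` and `‖y − x₀‖ ≥ ρ₀`. Proof: `prekernel_lieberman` with `T⋆ = (Ta + T)/2`,
`a′ = (ta + t)/2`, `b′ = (Ta + T⋆)/2`, `R = min 1 (min (ν(t − ta)) (ν(T⋆ − Ta)/7))`,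
`k = δ/(2CR)`, and the smallness of the box integrals far from the pole (`prekernel_box_subst`,
`prekernel_box_small` with `η = δ R^{n+2}/(2Cν)`). -/
theorem prekernel_decay {ν ta Ta T B t : ℝ} {b : ℝ → E → E} {x₀ : E} {w : ℝ × E → ℝ}
    {g : ℝ → E → ℝ} (hν : 0 < ν) (hTa : Ta < T) (ht : t ∈ Ioo ta Ta)
    (hb : IsSmoothSpaceTimeOn (Ico ta T) b) (hB : ∀ s ∈ Ico ta T, ∀ x, ‖b s x‖ ≤ B)
    (hw2 : MemLp w 2 volume) (hg : IsSmoothSpaceTimeOn (Ioo ta T) g)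
    (hae : ∀ᵐ p : ℝ × E, p ∈ Ioo ta T ×ˢ univ →
      backwardHeatKernel ν T x₀ p.1 p.2 + w p = g p.1 p.2)
    (heq : ∀ s ∈ Ioo ta T, ∀ x,
      deriv (fun r => g r x) s + fderiv ℝ (g s) x (b s x) + ν * (Δ (g s)) x = 0)
    {δ : ℝ} (hδ : 0 < δ) :
    ∃ ρ₀ : ℝ, ∀ s ∈ Icc t Ta, ∀ y, ρ₀ ≤ ‖y - x₀‖ → |g s y| ≤ δ := by
  -- the geometry
  obtain ⟨Ts, hTs⟩ : ∃ Ts : ℝ, Ts = (Ta + T) / 2 := ⟨_, rfl⟩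
  obtain ⟨a', ha'⟩ : ∃ a' : ℝ, a' = (ta + t) / 2 := ⟨_, rfl⟩
  obtain ⟨b', hb'⟩ : ∃ b' : ℝ, b' = (Ta + Ts) / 2 := ⟨_, rfl⟩
  have hTaTs : Ta < Ts := by rw [hTs]; linarith
  have hTsT : Ts < T := by rw [hTs]; linarith
  have hta' : ta < a' := by rw [ha']; linarith [ht.1]
  have ha't : a' < t := by rw [ha']; linarith [ht.1]
  have hab : a' ≤ b' := by rw [ha', hb']; linarith [ht.2]
  have hb's : b' < Ts := by rw [hb']; linarith
  have hb'T : b' < T := hb's.trans hTsT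
  have hm₁ : 0 < ν * (t - ta) := mul_pos hν (by linarith [ht.1])
  have hm₂ : 0 < ν * (Ts - Ta) / 7 := by positivity
  obtain ⟨R, hRdef⟩ : ∃ R : ℝ, R = min 1 (min (ν * (t - ta)) (ν * (Ts - Ta) / 7)) := ⟨_, rfl⟩
  have hR : 0 < R := by rw [hRdef]; exact lt_min one_pos (lt_min hm₁ hm₂)
  have hR1 : R ≤ 1 := by rw [hRdef]; exact min_le_left _ _
  have hRa : R ≤ ν * (t - ta) := by rw [hRdef]; exact (min_le_right _ _).trans (min_le_left _ _)
  have hRb : R ≤ ν * (Ts - Ta) / 7 := by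
    rw [hRdef]; exact (min_le_right _ _).trans (min_le_right _ _)
  have hRR : R ^ 2 ≤ R := by nlinarith
  have haR : 2 * ν * a' + R ^ 2 ≤ 2 * ν * t := by rw [ha']; nlinarith
  have hbR : 2 * ν * Ta + 7 * R ^ 2 ≤ 2 * ν * b' := by rw [hb']; nlinarith
  obtain ⟨C, hC, hL⟩ := prekernel_lieberman hν ht hTaTs hTsT hb hB hg heq hR hR1 hta' haR hbR hb's
  -- the smallness of the box integrals
  have hη : 0 < δ * R ^ (Module.finrank ℝ E + 2) / (2 * C * ν) := by positivity
  obtain ⟨ρ₀, hρ₀⟩ := prekernel_box_small (r := 2 * R) hν hta' hab hb'T hw2 hg hae hη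
  refine ⟨ρ₀, fun s hs y hy => ?_⟩
  have h1 := hL s hs y (δ / (2 * C * R)) (by positivity)
  rw [prekernel_box_subst hν hta' hab hb'T hg y] at h1
  have h2 := hρ₀ y hy
  have hRn : 0 < R ^ (Module.finrank ℝ E + 2) := by positivity
  calc |g s y| ≤ C * ((R ^ (Module.finrank ℝ E + 2))⁻¹ *
        (ν * ∫ p in Ioc a' b' ×ˢ ball y (2 * R), |g p.1 p.2|) + δ / (2 * C * R) * R) := h1
    _ ≤ C * ((R ^ (Module.finrank ℝ E + 2))⁻¹ *
        (ν * (δ * R ^ (Module.finrank ℝ E + 2) / (2 * C * ν))) + δ / (2 * C * R) * R) := by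
        gcongr
    _ = δ := by
        field_simp
        ring

end General

/-! ### The registered sub-goal (dimension three) -/

/-- **Registered sub-goal `stub_prekernelBounds_decay`** (the `ℝ³` form of `prekernel_decay`,
step (K1) of STUB `stub_prekernelBounds`): the smooth representative `g` of `Γ + w`
(`w ∈ L²`, vanishing conditions not needed) that solves `∂ₜg + b·∇g + νΔg = 0` classically on
the open slab tends to `0` at spatial infinity, uniformly on every block `[t, Ta] ⊆ (ta, T)`. -/
theorem stub_prekernelBounds_decay :
    ∀ (ν ta Ta T B t : ℝ) (b : ℝ → EuclideanSpace ℝ (Fin 3) → EuclideanSpace ℝ (Fin 3)) (x₀ : EuclideanSpace ℝ (Fin 3)) (w : ℝ × EuclideanSpace ℝ (Fin 3) → ℝ) (g : ℝ → EuclideanSpace ℝ (Fin 3) → ℝ), 0 < ν → Ta < T → t ∈ Ioo ta Ta → IsSmoothSpaceTimeOn (Ico ta T) b → (∀ s ∈ Ico ta T, ∀ x, ‖b s x‖ ≤ B) → MemLp w 2 volume → IsSmoothSpaceTimeOn (Ioo ta T) g → (∀ᵐ p : ℝ × EuclideanSpace ℝ (Fin 3), p ∈ Ioo ta T ×ˢ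 univ → backwardHeatKernel ν T x₀ p.1 p.2 + w p = g p.1 p.2) → (∀ s ∈ Ioo ta T, ∀ x, deriv (fun r => g r x) s + fderiv ℝ (g s) x (b s x) + ν * (Δ (g s)) x = 0) → ∀ δ : ℝ, 0 < δ → ∃ ρ₀ : ℝ, ∀ s ∈ Icc t Ta, ∀ y, ρ₀ ≤ ‖y - x₀‖ → |g s y| ≤ δ :=
  fun _ _ _ _ _ _ _ _ _ _ hν hTa ht hb hB hw2 hg hae heq _ hδ =>
    prekernel_decay hν hTa ht hb hB hw2 hg hae heq hδ

end Summit.NavierStokesRegularity.NavierStokesRegularity.Theorems.AdaptedKernelExists.NashEntropyLastBlock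

end
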